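import Literature.MathematicalPhysics.QuantumFieldTheory.Balaban1983to89.Node00.BgSchemeChartLinLie
import Literature.MathematicalPhysics.QuantumFieldTheory.Balaban1983to89.Node00.BgSchemePrOfRecordC
import Literature.MathematicalPhysics.QuantumFieldTheory.Balaban1983to89.Node00.BgSchemeOfRecordLie
import HarnessLib

/-!
# NODE 00 — `BgSchemePrOfRecordLie`: THE (47)-CARRYING LIE READING, THE FLAT VALUE AND THE Cⁿ CHART ENTRIES AT THE FRAMED SCHEME OF RECORD —
# `chartCfgLin T^{pr} 1 = 1` at the flat datum, (s-exp) and `hC`∕`hdiff` of the K0 junction at `bgSchemePrOfRecord … 𝔥 …` with (47) inside, by name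

Cell `pub-ymgap` (YM-PLAN Track A), seat `pub-ymgap-node00-def-Y` (g41; custodian of the `BgScheme` instance of record; Node00 definition lane;
count-neutral, `--supports stmt-QuantumFields-27238`).  ★★★ director-ym №629∕№630∕№631 (4)∕№632 (2): «(C) continuation» file (C3) — the RECORD
edition of ✓`Node00.BgSchemeChartLinLie` ((C1): generic (47)-carrying Lie reading `lieExpoLin S T`, token `LieLinTokAt`, seam
`chartCfgLin_eq_expChart_one`, flat value `chartCfgLin_eq_bg`, Cⁿ transport) at the FRAMED, (47)-CARRYING scheme of record ✓`bgSchemePrOfRecord F N K k Ω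
U₀ 𝔥 dom …` ((A4) `Node00.BgSchemePrOfRecord`) read with its own (47)-slot `T^{pr} := linPrOfRecord … 𝔥 levB a hposb hQ ε_C` (`= fun _ => T47 H₁^{pr}
C^{sl,pr} ε_C`), and of its complex-datum edition ✓`Node00.BgSchemePrOfRecordC` ((C2)); the framed twin, decl by decl, of ✓`Node00.BgSchemeOfRecordLie`
(def-Y g38, unframed, (47)-free).  №632 (2) (Q-B) «BOTH LAYERS, PRIMITIVE FIRST»: every (47)-row is stated over the PRIMITIVE letters — the
analyticity of (47) on the ball `‖A′‖ < a_C` (`LinPrAnalyticTok`, (C2)) and, for the flat rows, `T^{pr}_1(0) = 0` (`hT0`) — with ONE `…_of_regimeC`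
corollary each deriving the primitive from the framed Sect. C regime `(RC) (hC) (haC)` (lit ✓`analyticOnNhd_T47` ∕ ✓`T47_zero`).
[B11] = [Balaban1985Variational] (CMP **102** (1985) 277–309).

WHAT (the by-name sockets of the K0ᴬ continuation re-key past the G-door — P3's `…K0AxSchemeOfRecordLetters` №20–№23 twins, ◆'s `h1`∕`hC`∕`hdiff`
at the framed scheme):
* §1 the presentation `ev = η·evLit` of the framed scheme is CONTINUOUS and its `ev`-presented real sector CLOSED (finite dimension) — the analytic
  premises of the generic files at the framed record; `T^{pr}_V(0) = 0` from the framed Sect. C regime (lit ✓`T47_zero`; the (47)-slot is `V`-constant).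
* §2 the natural open set of complex data `logPolydiscPrOfRecord` (log-polydisc ∩ `‖𝔄^{pr,ᶜ}‖ < a𝔄`), open, containing the averaged background's datum.
* §3 Cⁿ ALONG A DATUM MAP at the framed record: the full small field `x ↦ 𝒜(u x) + 𝔄(u x)` ((C2)'s analytic `𝒜^{pr,ᶜ}` composed with a `Cⁿ` coefficient
  field; `…_of_regimeTok` from the scheme's `RegimeTok` + Prop. 4's `WAnalyticPrTok`); ★ the TRANSFORMED full small field `x ↦ T^{pr}(𝒜 + 𝔄)(u x)`
  (primitive: `LinPrAnalyticTok` + the full small field at `x₀` in the ball `‖·‖ < a_C`; `…_of_regimeTok`: the ball membership from `‖𝒜‖ ≤ ε₄`,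
  `‖𝔄‖ < a𝔄`, `ε₄ + a𝔄 ≤ a_C`; `…_of_regimeC`: the token from `RC` + (ℓa-C)); hence ★ the (47)-carrying chart matrix entries `x ↦ (chartCfgLin T^{pr} (u x))(b)`
  and the Lie reading `x ↦ lieExpoLin T^{pr} (u x)` are `Cⁿ` at `x₀` (◆'s `hC`∕`hdiff`; (C1)'s generic transport), in the same three layers, the eventual
  Lie token along `u` DISPLAYED (the reality programme's output).
* §4 THE FLAT DATUM at `U₀ = 1` (one frame datum `𝔥 : FrameDatum (F.P K) N k 1` as a binder): `J ≡ 0`, `𝔄(1) = 0`, hence under the displayed `RegimeTok`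
  and `1 ∈ dom`: `𝒜(1) = 0`; and with `T^{pr}_1(0) = 0` (primitive `hT0`, or the framed Sect. C regime): the Lie token at `1`, `lieExpoLin T^{pr} 1 = 0`,
  ★★ `chartCfgLin T^{pr} 1 = 1` (the junction's `h1` with (47) inside); (s-exp) along a datum map in eventual form; the flat datum in `logPolydiscPrOfRecord`.

HONEST.  Theorems over the tree's definitions plus ONE open-set definition with body; nothing of [B11] asserted: the regime (117)–(121), Prop. 4's and
Prop. 3's analyticity (or the framed Sect. C regime `RC` + `Prop4Hyp`), the radius inequality, `hposπ`∕`hposb`∕`hQ` (supplier of record GL-only) and the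
eventual Lie token stay DISPLAYED; no row of the reality programme is discharged here; `k`-uniformity is the consumer's quantifier order.  No `sorry`,
no new axiom, no instance ∕ notation; no landed file edited.  Nothing here is a claim about the Yang–Mills mass gap (`Summit.QuantumFields`): finite
torus, fixed `ε`; not continuum, not OS, not Clay.
-/

noncomputable section

open scoped Matrix Matrix.Norms.L2Operator InnerProductSpace ComplexConjugate Topology

namespace Literature.MathematicalPhysics.QuantumFieldTheory.Balaban1983to89.Node00

open _root_.Filter
open T4Continuum BlockAveraging
open NormedSpace (exp)
open B11Eq103H1Complex (BondL2K SiteL2K)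
open B11Eq115Space (Space115 NegSize NegSup JetSup levWeight)
open B11Eq174Chart (Regime solA)
open B11Prop6Scheme (Prop4Hyp)
open B11Eq90V0GroupComposed (T47 T47_zero)

section Record

variable (F : T4Family) (N : ℕ) [NeZero N] (K : ℕ) (k : ℕ) (Ω : ℕ → Set (Site (F.P K) 0)) (U₀ : GaugeField (F.P K) 0 (SU N))
variable [Fact (0 < (F.L : ℝ))] [Fact (0 < (F.P K).eta k)] [Fact (0 < c0Rec F K k)] [Fact (∀ c, 0 < wBRec F K k c)]
variable (𝔥 : FrameDatum (F.P K) N k U₀) (dom : Set (GaugeField (F.P K) k (SU N))) (levB : PBond (F.P K) k → ℕ)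
  (Gp : SiteL2K ℂ (F.P K).d (fun _ => (F.P K).sitesPerDir 0) (c0Rec F K k) (WRec N) →ₗ[ℂ]
    SiteL2K ℂ (F.P K).d (fun _ => (F.P K).sitesPerDir 0) (c0Rec F K k) (WRec N))
  (Δ2 : BondL2K ℂ (F.P K).d (fun _ => (F.P K).sitesPerDir 0) (c0Rec F K k) (WRec N) →ₗ[ℂ]
    BondL2K ℂ (F.P K).d (fun _ => (F.P K).sitesPerDir 0) (c0Rec F K k) (WRec N)) (a : ℝ)
  (hposπ : ∀ x, x ≠ 0 → 0 < RCLike.re ⟪x, laplaceAOfRecordAt F N k U₀ (hessOpOfRecord128 F N k U₀ Gp (QprimeOfRecord F N k U₀) Δ2)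
    (QprOfRecord F N k U₀ 𝔥) (QprimeOfRecord F N k U₀) a x⟫_ℂ)
  (hposb : ∀ x, x ≠ 0 → 0 < RCLike.re ⟪x, laplaceAOfRecord F N k U₀ (QprOfRecord F N k U₀ 𝔥) (QprimeOfRecord F N k U₀) a x⟫_ℂ)
  (hQ : Function.Surjective (QprOfRecord F N k U₀ 𝔥)) (εC B₀ C₄ a₃ j a𝔄 ε₄ : ℝ)

/-! ## §1. The analytic premises of the generic files at the framed record; `T^{pr}(0) = 0` -/

/-- **The presentation `ev = η·evLit` of the framed scheme of record is continuous** (a linear map on the finite-dimensional (115)-space).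
[cite: Balaban1985Variational, (19) p.281, (115) p.294 (bookkeeping)] -/
theorem bgSchemePrOfRecord_continuous_ev :
    Continuous (bgSchemePrOfRecord F N K k Ω U₀ 𝔥 dom levB Gp Δ2 a hposπ hposb hQ εC B₀ C₄ a₃ j a𝔄 ε₄).ev :=
  LinearMap.continuous_of_finiteDimensional _

/-- The `ev`-presented real sector of the framed scheme of record is closed (finite dimension). [cite: Balaban1985Variational, (115) p.294 (bookkeeping)] -/
theorem bgSchemePrOfRecord_isClosed_evHerm0 :
    IsClosed ((bgSchemePrOfRecord F N K k Ω U₀ 𝔥 dom levB Gp Δ2 a hposπ hposb hQ εC B₀ C₄ a₃ j a𝔄 ε₄).evHerm0 :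
      Set (Space115Lit F N K k Ω U₀)) :=
  BgScheme.isClosed_evHerm0

/-- **`T^{pr}_V(0) = 0` FROM THE FRAMED SECT. C REGIME**: (47) fixes the origin (`D(0) = 0`, the selected solution at zero data is `0`) — lit ✓`T47_zero`
under the DISPLAYED `Regime H₁^{pr} 0 C^{sl,pr} b 0 C₂ c₄ 0 a_C ε_C` and `0 < a_C`; the record's supplier of the primitive letter `hT0` of the flat rows
(§4 and (C1) `BgScheme.chartCfgLin_eq_bg`). [cite: Balaban1985Variational, (47) p.285, Prop. 3 p.289, (52)–(54) p.286] -/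
theorem linPrOfRecord_apply_zero {b C₂ c₄ aC : ℝ}
    (RC : Regime (H1prOfRecordAtBg F N K k Ω U₀ 𝔥 levB a hposb hQ) (0 : Space115Lit F N K k Ω U₀ →L[ℂ] Space115Lit F N K k Ω U₀)
      (CslprOfRecord F N K k Ω U₀ 𝔥 levB) b 0 C₂ c₄ 0 aC εC)
    (haC : 0 < aC) (V : GaugeField (F.P K) k (SU N)) :
    linPrOfRecord F N K k Ω U₀ 𝔥 levB a hposb hQ εC V 0 = 0 :=
  T47_zero RC haC

/-! ## §2. The natural open set of complex data at the framed record -/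

/-- **THE NATURAL OPEN SET OF COMPLEX DATA, FRAMED**: the log-polydisc around the averaged background `‖Z(c)(Ū^kU₀)(c)⋆ − 1‖ < 1` (where `Bᶜ`, `𝔄^{pr,ᶜ}` are
analytic) cut by the shift bound `‖𝔄^{pr,ᶜ}(Z)‖ < a𝔄` of Prop. 6. [cite: Balaban1985Variational, Sect. G p.307, Prop. 6 p.295, (115) p.294, Prop. 9 p.309] -/
def logPolydiscPrOfRecord : Set (PBond (F.P K) k → Matrix (Fin N) (Fin N) ℂ) :=
  {Z | ∀ c : PBond (F.P K) k, ‖Z c * star (Averaging.iter (avOfRecord F N K) k U₀ c : Matrix (Fin N) (Fin N) ℂ) - 1‖ < 1} ∩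
    {Z | ‖frakAprOfRecordAtBg128C F N K k Ω U₀ 𝔥 levB Gp Δ2 a hposπ hQ Z‖ < a𝔄}

/-- The log-polydisc condition holds on `logPolydiscPrOfRecord`. [cite: Balaban1985Variational, Sect. G p.307 (bookkeeping)] -/
theorem logPolydiscPrOfRecord_log {Z : PBond (F.P K) k → Matrix (Fin N) (Fin N) ℂ}
    (hZ : Z ∈ logPolydiscPrOfRecord F N K k Ω U₀ 𝔥 levB Gp Δ2 a hposπ hQ a𝔄) (c : PBond (F.P K) k) :
    ‖Z c * star (Averaging.iter (avOfRecord F N K) k U₀ c : Matrix (Fin N) (Fin N) ℂ) - 1‖ < 1 :=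
  hZ.1 c

/-- The shift bound holds on `logPolydiscPrOfRecord`. [cite: Balaban1985Variational, Prop. 6 (115) p.294 (bookkeeping)] -/
theorem logPolydiscPrOfRecord_frakApr {Z : PBond (F.P K) k → Matrix (Fin N) (Fin N) ℂ}
    (hZ : Z ∈ logPolydiscPrOfRecord F N K k Ω U₀ 𝔥 levB Gp Δ2 a hposπ hQ a𝔄) :
    ‖frakAprOfRecordAtBg128C F N K k Ω U₀ 𝔥 levB Gp Δ2 a hposπ hQ Z‖ < a𝔄 :=
  hZ.2

/-- `logPolydiscPrOfRecord` is OPEN (the polydisc is a finite intersection of open sets; `𝔄^{pr,ᶜ}` is continuous on it).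
[cite: Balaban1985Variational, Sect. G p.307 (bookkeeping)] -/
theorem isOpen_logPolydiscPrOfRecord : IsOpen (logPolydiscPrOfRecord F N K k Ω U₀ 𝔥 levB Gp Δ2 a hposπ hQ a𝔄) := by
  have hpoly : IsOpen {Z : PBond (F.P K) k → Matrix (Fin N) (Fin N) ℂ |
      ∀ c : PBond (F.P K) k, ‖Z c * star (Averaging.iter (avOfRecord F N K) k U₀ c : Matrix (Fin N) (Fin N) ℂ) - 1‖ < 1} := by
    rw [show {Z : PBond (F.P K) k → Matrix (Fin N) (Fin N) ℂ |
        ∀ c : PBond (F.P K) k, ‖Z c * star (Averaging.iter (avOfRecord F N K) k U₀ c : Matrix (Fin N) (Fin N) ℂ) - 1‖ < 1} =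
        ⋂ c : PBond (F.P K) k, {Z | ‖Z c * star (Averaging.iter (avOfRecord F N K) k U₀ c : Matrix (Fin N) (Fin N) ℂ) - 1‖ < 1} from
      Set.ext fun Z => by simp only [Set.mem_setOf_eq, Set.mem_iInter]]
    exact isOpen_iInter_of_finite fun c =>
      isOpen_lt (((continuous_apply c).mul continuous_const).sub continuous_const).norm continuous_const
  have hcont : ContinuousOn (fun Z => ‖frakAprOfRecordAtBg128C F N K k Ω U₀ 𝔥 levB Gp Δ2 a hposπ hQ Z‖)
      {Z : PBond (F.P K) k → Matrix (Fin N) (Fin N) ℂ |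
        ∀ c : PBond (F.P K) k, ‖Z c * star (Averaging.iter (avOfRecord F N K) k U₀ c : Matrix (Fin N) (Fin N) ℂ) - 1‖ < 1} :=
    fun Z hZ => ((analyticAt_frakAprOfRecordAtBg128C F N K k Ω U₀ 𝔥 levB Gp Δ2 a hposπ hQ hZ).continuousAt.norm).continuousWithinAt
  exact hcont.isOpen_inter_preimage hpoly isOpen_Iio

/-- **The averaged background's own datum lies in `logPolydiscPrOfRecord`** (`Ū^kU₀ · (Ū^kU₀)⋆ = 1`, `𝔄^{pr,ᶜ}(Ū^kU₀) = 0 < a𝔄`). At `U₀ = 1` this is the flat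
datum `coeField 1` (§4). [cite: Balaban1985Variational, (20) p.281, (103) p.293, Prop. 6 p.295] -/
theorem coeField_iter_mem_logPolydiscPrOfRecord (ha : 0 < a𝔄) :
    coeField (Averaging.iter (avOfRecord F N K) k U₀) ∈ logPolydiscPrOfRecord F N K k Ω U₀ 𝔥 levB Gp Δ2 a hposπ hQ a𝔄 := by
  refine ⟨fun c => ?_, ?_⟩
  · rw [coeField_apply, coe_mul_star_coe_SU, sub_self, norm_zero]
    exact one_pos
  · show ‖frakAprOfRecordAtBg128C F N K k Ω U₀ 𝔥 levB Gp Δ2 a hposπ hQ (coeField (Averaging.iter (avOfRecord F N K) k U₀))‖ < a𝔄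
    rw [frakAprOfRecordAtBg128C_self, norm_zero]
    exact ha

/-! ## §3. Cⁿ of the full small field, of its (47)-transform and of the (47)-carrying chart entries along a datum map, at the framed record -/

variable {E : Type*} [NormedAddCommGroup E] [NormedSpace ℝ E]

/-- **Cⁿ OF THE FULL SMALL FIELD `x ↦ 𝒜(u x) + 𝔄(u x)` ALONG A DATUM MAP, FRAMED** from (C2)'s ℂ-analyticity of `𝒜^{pr,ᶜ}` on an open set `𝒪` of complex
data inside the log-polydisc and the `Cⁿ` class of the coefficient field `x ↦ coeField (u x)` (reality `𝒜^{pr,ᶜ} ∘ coeField = 𝒜`, `𝔄^{pr,ᶜ} ∘ coeField = 𝔄`,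
`rfl`). [cite: Balaban1985Variational, Prop. 9 p.309, Prop. 6 (116) p.295] -/
theorem bgSchemePrOfRecord_contDiffAt_sol_add_shift_comp {n : WithTop ℕ∞} {𝒪 : Set (PBond (F.P K) k → Matrix (Fin N) (Fin N) ℂ)}
    (hsol : AnalyticOnNhd ℂ (solPrOfRecordC F N K k Ω U₀ 𝔥 levB Gp Δ2 a hposπ hposb hQ εC ε₄) 𝒪)
    (hlog : ∀ Z ∈ 𝒪, ∀ c : PBond (F.P K) k, ‖Z c * star (Averaging.iter (avOfRecord F N K) k U₀ c : Matrix (Fin N) (Fin N) ℂ) - 1‖ < 1)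
    {u : E → GaugeField (F.P K) k (SU N)} {x₀ : E} (hu : ContDiffAt ℝ n (fun x => coeField (u x)) x₀) (hx₀ : coeField (u x₀) ∈ 𝒪) :
    ContDiffAt ℝ n (fun x => (bgSchemePrOfRecord F N K k Ω U₀ 𝔥 dom levB Gp Δ2 a hposπ hposb hQ εC B₀ C₄ a₃ j a𝔄 ε₄).sol (u x) +
      (bgSchemePrOfRecord F N K k Ω U₀ 𝔥 dom levB Gp Δ2 a hposπ hposb hQ εC B₀ C₄ a₃ j a𝔄 ε₄).𝔄 (u x)) x₀ := by
  have h1 : ContDiffAt ℝ n (fun x => solPrOfRecordC F N K k Ω U₀ 𝔥 levB Gp Δ2 a hposπ hposb hQ εC ε₄ (coeField (u x))) x₀ :=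
    ContDiffAt.comp (g := solPrOfRecordC F N K k Ω U₀ 𝔥 levB Gp Δ2 a hposπ hposb hQ εC ε₄) (f := fun x => coeField (u x)) x₀
      ((hsol _ hx₀).contDiffAt.restrict_scalars ℝ) hu
  have h2 : ContDiffAt ℝ n (fun x => frakAprOfRecordAtBg128C F N K k Ω U₀ 𝔥 levB Gp Δ2 a hposπ hQ (coeField (u x))) x₀ :=
    ContDiffAt.comp (g := frakAprOfRecordAtBg128C F N K k Ω U₀ 𝔥 levB Gp Δ2 a hposπ hQ) (f := fun x => coeField (u x)) x₀
      ((analyticAt_frakAprOfRecordAtBg128C F N K k Ω U₀ 𝔥 levB Gp Δ2 a hposπ hQ (hlog _ hx₀)).contDiffAt.restrict_scalars ℝ) hu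
  show ContDiffAt ℝ n (fun x => solPrOfRecordC F N K k Ω U₀ 𝔥 levB Gp Δ2 a hposπ hposb hQ εC ε₄ (coeField (u x)) +
    frakAprOfRecordAtBg128C F N K k Ω U₀ 𝔥 levB Gp Δ2 a hposπ hQ (coeField (u x))) x₀
  exact h1.add h2

/-- The same from the DISPLAYED tokens: the framed scheme's regime `RegimeTok` (read at any `V₀ ∈ dom`) and Prop. 4's analyticity `WAnalyticPrTok`, on the
natural open set `logPolydiscPrOfRecord`. [cite: Balaban1985Variational, Prop. 9 p.309, Prop. 6 (116)–(121) p.295, Prop. 4 p.292] -/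
theorem bgSchemePrOfRecord_contDiffAt_sol_add_shift_comp_of_regimeTok {n : WithTop ℕ∞}
    (hT : (bgSchemePrOfRecord F N K k Ω U₀ 𝔥 dom levB Gp Δ2 a hposπ hposb hQ εC B₀ C₄ a₃ j a𝔄 ε₄).RegimeTok)
    {V₀ : GaugeField (F.P K) k (SU N)} (hV₀ : V₀ ∈ dom) (hW : WAnalyticPrTok F N K k Ω U₀ 𝔥 levB Gp a hposb hQ εC a₃)
    {u : E → GaugeField (F.P K) k (SU N)} {x₀ : E} (hu : ContDiffAt ℝ n (fun x => coeField (u x)) x₀)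
    (hx₀ : coeField (u x₀) ∈ logPolydiscPrOfRecord F N K k Ω U₀ 𝔥 levB Gp Δ2 a hposπ hQ a𝔄) :
    ContDiffAt ℝ n (fun x => (bgSchemePrOfRecord F N K k Ω U₀ 𝔥 dom levB Gp Δ2 a hposπ hposb hQ εC B₀ C₄ a₃ j a𝔄 ε₄).sol (u x) +
      (bgSchemePrOfRecord F N K k Ω U₀ 𝔥 dom levB Gp Δ2 a hposπ hposb hQ εC B₀ C₄ a₃ j a𝔄 ε₄).𝔄 (u x)) x₀ :=
  bgSchemePrOfRecord_contDiffAt_sol_add_shift_comp F N K k Ω U₀ 𝔥 dom levB Gp Δ2 a hposπ hposb hQ εC B₀ C₄ a₃ j a𝔄 ε₄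
    (analyticOnNhd_solPrOfRecordC_of_regimeTok F N K k Ω U₀ 𝔥 levB Gp Δ2 a hposπ hposb hQ hT hV₀
      (isOpen_logPolydiscPrOfRecord F N K k Ω U₀ 𝔥 levB Gp Δ2 a hposπ hQ a𝔄) (fun _ hZ => hZ.2) (fun _ hZ => hZ.1) hW)
    (fun _ hZ => hZ.1) hu hx₀

/-- ★★ **Cⁿ OF THE TRANSFORMED FULL SMALL FIELD `x ↦ T^{pr}(𝒜(u x) + 𝔄(u x))` ALONG A DATUM MAP, FRAMED** (PRIMITIVE FORM; the premise `hd` of (C1)'s Cⁿ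
transport for the slot `T^{pr}`): the `Cⁿ` full small field (from (C2)'s analytic `𝒜^{pr,ᶜ}` on `𝒪`) composed with (47), which is ℂ-analytic on the ball
`‖A′‖ < a_C` (DISPLAYED token `LinPrAnalyticTok`) containing the full small field at `x₀` (DISPLAYED `hA`) — Prop. 9 with Prop. 3 at the framed record.
[cite: Balaban1985Variational, Prop. 9 p.309, Prop. 3 p.289, (47) p.285, Prop. 6 (116) p.295] -/
theorem bgSchemePrOfRecord_contDiffAt_linPr_sol_add_shift_comp {n : WithTop ℕ∞} {𝒪 : Set (PBond (F.P K) k → Matrix (Fin N) (Fin N) ℂ)}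
    (hsol : AnalyticOnNhd ℂ (solPrOfRecordC F N K k Ω U₀ 𝔥 levB Gp Δ2 a hposπ hposb hQ εC ε₄) 𝒪)
    (hlog : ∀ Z ∈ 𝒪, ∀ c : PBond (F.P K) k, ‖Z c * star (Averaging.iter (avOfRecord F N K) k U₀ c : Matrix (Fin N) (Fin N) ℂ) - 1‖ < 1)
    {u : E → GaugeField (F.P K) k (SU N)} {x₀ : E} (hu : ContDiffAt ℝ n (fun x => coeField (u x)) x₀) (hx₀ : coeField (u x₀) ∈ 𝒪) {aC : ℝ}
    (hTan : LinPrAnalyticTok F N K k Ω U₀ 𝔥 levB a hposb hQ εC aC)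
    (hA : ‖(bgSchemePrOfRecord F N K k Ω U₀ 𝔥 dom levB Gp Δ2 a hposπ hposb hQ εC B₀ C₄ a₃ j a𝔄 ε₄).sol (u x₀) +
      (bgSchemePrOfRecord F N K k Ω U₀ 𝔥 dom levB Gp Δ2 a hposπ hposb hQ εC B₀ C₄ a₃ j a𝔄 ε₄).𝔄 (u x₀)‖ < aC) :
    ContDiffAt ℝ n (fun x => linPrOfRecord F N K k Ω U₀ 𝔥 levB a hposb hQ εC (u x)
      ((bgSchemePrOfRecord F N K k Ω U₀ 𝔥 dom levB Gp Δ2 a hposπ hposb hQ εC B₀ C₄ a₃ j a𝔄 ε₄).sol (u x) +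
        (bgSchemePrOfRecord F N K k Ω U₀ 𝔥 dom levB Gp Δ2 a hposπ hposb hQ εC B₀ C₄ a₃ j a𝔄 ε₄).𝔄 (u x))) x₀ := by
  have hτ : ContDiffAt ℝ n (T47 (H1prOfRecordAtBg F N K k Ω U₀ 𝔥 levB a hposb hQ) (CslprOfRecord F N K k Ω U₀ 𝔥 levB) εC)
      ((bgSchemePrOfRecord F N K k Ω U₀ 𝔥 dom levB Gp Δ2 a hposπ hposb hQ εC B₀ C₄ a₃ j a𝔄 ε₄).sol (u x₀) +
        (bgSchemePrOfRecord F N K k Ω U₀ 𝔥 dom levB Gp Δ2 a hposπ hposb hQ εC B₀ C₄ a₃ j a𝔄 ε₄).𝔄 (u x₀)) :=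
    (hTan _ (mem_ball_zero_iff.2 hA)).contDiffAt.restrict_scalars ℝ
  exact BgScheme.contDiffAt_constSlot_sol_add_shift_comp _ hτ
    (bgSchemePrOfRecord_contDiffAt_sol_add_shift_comp F N K k Ω U₀ 𝔥 dom levB Gp Δ2 a hposπ hposb hQ εC B₀ C₄ a₃ j a𝔄 ε₄ hsol hlog hu hx₀)

/-- ★★ **THE SAME FROM THE DISPLAYED TOKENS** (`RegimeTok` at any `V₀ ∈ dom`, `WAnalyticPrTok`, the datum in `logPolydiscPrOfRecord`, `LinPrAnalyticTok`, and
the radius inequality `ε₄ + a𝔄 ≤ a_C`, which puts the full small field in the ball: `‖𝒜‖ ≤ ε₄` by lit ✓`Regime.solA_mem`, `‖𝔄‖ < a𝔄` on the open set).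
[cite: Balaban1985Variational, Prop. 9 p.309, Prop. 3 p.289, (47) p.285, Prop. 6 (116)–(121) p.295, Prop. 4 p.292] -/
theorem bgSchemePrOfRecord_contDiffAt_linPr_sol_add_shift_comp_of_regimeTok {n : WithTop ℕ∞}
    (hT : (bgSchemePrOfRecord F N K k Ω U₀ 𝔥 dom levB Gp Δ2 a hposπ hposb hQ εC B₀ C₄ a₃ j a𝔄 ε₄).RegimeTok)
    {V₀ : GaugeField (F.P K) k (SU N)} (hV₀ : V₀ ∈ dom) (hW : WAnalyticPrTok F N K k Ω U₀ 𝔥 levB Gp a hposb hQ εC a₃)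
    {u : E → GaugeField (F.P K) k (SU N)} {x₀ : E} (hu : ContDiffAt ℝ n (fun x => coeField (u x)) x₀)
    (hx₀ : coeField (u x₀) ∈ logPolydiscPrOfRecord F N K k Ω U₀ 𝔥 levB Gp Δ2 a hposπ hQ a𝔄) {aC : ℝ}
    (hTan : LinPrAnalyticTok F N K k Ω U₀ 𝔥 levB a hposb hQ εC aC) (haC : ε₄ + a𝔄 ≤ aC) :
    ContDiffAt ℝ n (fun x => linPrOfRecord F N K k Ω U₀ 𝔥 levB a hposb hQ εC (u x)
      ((bgSchemePrOfRecord F N K k Ω U₀ 𝔥 dom levB Gp Δ2 a hposπ hposb hQ εC B₀ C₄ a₃ j a𝔄 ε₄).sol (u x) +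
        (bgSchemePrOfRecord F N K k Ω U₀ 𝔥 dom levB Gp Δ2 a hposπ hposb hQ εC B₀ C₄ a₃ j a𝔄 ε₄).𝔄 (u x))) x₀ :=
  bgSchemePrOfRecord_contDiffAt_linPr_sol_add_shift_comp F N K k Ω U₀ 𝔥 dom levB Gp Δ2 a hposπ hposb hQ εC B₀ C₄ a₃ j a𝔄 ε₄
    (analyticOnNhd_solPrOfRecordC_of_regimeTok F N K k Ω U₀ 𝔥 levB Gp Δ2 a hposπ hposb hQ hT hV₀
      (isOpen_logPolydiscPrOfRecord F N K k Ω U₀ 𝔥 levB Gp Δ2 a hposπ hQ a𝔄) (fun _ hZ => hZ.2) (fun _ hZ => hZ.1) hW)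
    (fun _ hZ => hZ.1) hu hx₀ hTan
    (norm_solPrOfRecordC_add_frakApr_lt F N K k Ω U₀ 𝔥 levB Gp Δ2 a hposπ hposb hQ (hT V₀ hV₀).1 (hT V₀ hV₀).2.1 hx₀.2 haC)

/-- ★★ **THE SAME FROM THE FRAMED SECT. C REGIME** (`RC : Regime H₁^{pr} 0 C^{sl,pr} b 0 C₂ c₄ 0 a_C ε_C`, `Prop4Hyp C^{sl,pr} C₂ c₄`, `ε₄ + a𝔄 ≤ a_C` DISPLAYED;
(C2) `linPrAnalyticTok_of_regimeC` = lit ✓`analyticOnNhd_T47`). [cite: Balaban1985Variational, Prop. 9 p.309, Prop. 3 p.289, (47) p.285, (52)–(54) p.286] -/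
theorem bgSchemePrOfRecord_contDiffAt_linPr_sol_add_shift_comp_of_regimeC {n : WithTop ℕ∞}
    (hT : (bgSchemePrOfRecord F N K k Ω U₀ 𝔥 dom levB Gp Δ2 a hposπ hposb hQ εC B₀ C₄ a₃ j a𝔄 ε₄).RegimeTok)
    {V₀ : GaugeField (F.P K) k (SU N)} (hV₀ : V₀ ∈ dom) (hW : WAnalyticPrTok F N K k Ω U₀ 𝔥 levB Gp a hposb hQ εC a₃)
    {u : E → GaugeField (F.P K) k (SU N)} {x₀ : E} (hu : ContDiffAt ℝ n (fun x => coeField (u x)) x₀)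
    (hx₀ : coeField (u x₀) ∈ logPolydiscPrOfRecord F N K k Ω U₀ 𝔥 levB Gp Δ2 a hposπ hQ a𝔄) {b C₂ c₄ aC : ℝ}
    (RC : Regime (H1prOfRecordAtBg F N K k Ω U₀ 𝔥 levB a hposb hQ) (0 : Space115Lit F N K k Ω U₀ →L[ℂ] Space115Lit F N K k Ω U₀)
      (CslprOfRecord F N K k Ω U₀ 𝔥 levB) b 0 C₂ c₄ 0 aC εC)
    (hC : Prop4Hyp (CslprOfRecord F N K k Ω U₀ 𝔥 levB) C₂ c₄) (haC : ε₄ + a𝔄 ≤ aC) :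
    ContDiffAt ℝ n (fun x => linPrOfRecord F N K k Ω U₀ 𝔥 levB a hposb hQ εC (u x)
      ((bgSchemePrOfRecord F N K k Ω U₀ 𝔥 dom levB Gp Δ2 a hposπ hposb hQ εC B₀ C₄ a₃ j a𝔄 ε₄).sol (u x) +
        (bgSchemePrOfRecord F N K k Ω U₀ 𝔥 dom levB Gp Δ2 a hposπ hposb hQ εC B₀ C₄ a₃ j a𝔄 ε₄).𝔄 (u x))) x₀ :=
  bgSchemePrOfRecord_contDiffAt_linPr_sol_add_shift_comp_of_regimeTok F N K k Ω U₀ 𝔥 dom levB Gp Δ2 a hposπ hposb hQ εC B₀ C₄ a₃ j a𝔄 ε₄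
    hT hV₀ hW hu hx₀ (linPrAnalyticTok_of_regimeC F N K k Ω U₀ 𝔥 levB a hposb hQ RC hC) haC

/-- ★★ **Cⁿ OF THE (47)-CARRYING CHART MATRIX ENTRIES ALONG A DATUM MAP AT THE FRAMED RECORD** (◆'s `hC`∕`hdiff` with (47) inside; PRIMITIVE FORM): from a
`Cⁿ` transformed full small field (the premise `hd`, e.g. the three lemmas above), the constant background `bg ≡ U₀` and the Lie token eventually along `u`
(DISPLAYED — the reality programme's output; at the flat datum it holds by §4), via (C1) `BgScheme.contDiffAt_coe_chartCfgLin_comp_pi`.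
[cite: Balaban1985Variational, Prop. 9 p.309, (15) p.280, (47) p.285] -/
theorem bgSchemePrOfRecord_contDiffAt_coe_chartCfgLin_comp_pi {n : WithTop ℕ∞} {u : E → GaugeField (F.P K) k (SU N)} {x₀ : E}
    (htok : ∀ᶠ x in 𝓝 x₀, (bgSchemePrOfRecord F N K k Ω U₀ 𝔥 dom levB Gp Δ2 a hposπ hposb hQ εC B₀ C₄ a₃ j a𝔄 ε₄).LieLinTokAt
      (linPrOfRecord F N K k Ω U₀ 𝔥 levB a hposb hQ εC) (u x))
    (hd : ContDiffAt ℝ n (fun x => linPrOfRecord F N K k Ω U₀ 𝔥 levB a hposb hQ εC (u x)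
      ((bgSchemePrOfRecord F N K k Ω U₀ 𝔥 dom levB Gp Δ2 a hposπ hposb hQ εC B₀ C₄ a₃ j a𝔄 ε₄).sol (u x) +
        (bgSchemePrOfRecord F N K k Ω U₀ 𝔥 dom levB Gp Δ2 a hposπ hposb hQ εC B₀ C₄ a₃ j a𝔄 ε₄).𝔄 (u x))) x₀) :
    ContDiffAt ℝ n (fun x (b : PBond (F.P K) 0) =>
      (((bgSchemePrOfRecord F N K k Ω U₀ 𝔥 dom levB Gp Δ2 a hposπ hposb hQ εC B₀ C₄ a₃ j a𝔄 ε₄).chartCfgLin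
        (linPrOfRecord F N K k Ω U₀ 𝔥 levB a hposb hQ εC) (u x) b : SU N) : Matrix (Fin N) (Fin N) ℂ)) x₀ :=
  BgScheme.contDiffAt_coe_chartCfgLin_comp_pi _ _
    (bgSchemePrOfRecord_continuous_ev F N K k Ω U₀ 𝔥 dom levB Gp Δ2 a hposπ hposb hQ εC B₀ C₄ a₃ j a𝔄 ε₄) (U₀ := U₀) (fun _ => rfl) htok hd

/-- ★★ **THE SAME FROM THE DISPLAYED TOKENS** (`RegimeTok`, `WAnalyticPrTok`, the datum in `logPolydiscPrOfRecord`, `LinPrAnalyticTok`, `ε₄ + a𝔄 ≤ a_C`, the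
eventual Lie token). [cite: Balaban1985Variational, Prop. 9 p.309, Prop. 3 p.289, (15) p.280, (47) p.285, Prop. 6 p.295] -/
theorem bgSchemePrOfRecord_contDiffAt_coe_chartCfgLin_comp_pi_of_regimeTok {n : WithTop ℕ∞}
    (hT : (bgSchemePrOfRecord F N K k Ω U₀ 𝔥 dom levB Gp Δ2 a hposπ hposb hQ εC B₀ C₄ a₃ j a𝔄 ε₄).RegimeTok)
    {V₀ : GaugeField (F.P K) k (SU N)} (hV₀ : V₀ ∈ dom) (hW : WAnalyticPrTok F N K k Ω U₀ 𝔥 levB Gp a hposb hQ εC a₃)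
    {u : E → GaugeField (F.P K) k (SU N)} {x₀ : E} (hu : ContDiffAt ℝ n (fun x => coeField (u x)) x₀)
    (hx₀ : coeField (u x₀) ∈ logPolydiscPrOfRecord F N K k Ω U₀ 𝔥 levB Gp Δ2 a hposπ hQ a𝔄) {aC : ℝ}
    (hTan : LinPrAnalyticTok F N K k Ω U₀ 𝔥 levB a hposb hQ εC aC) (haC : ε₄ + a𝔄 ≤ aC)
    (htok : ∀ᶠ x in 𝓝 x₀, (bgSchemePrOfRecord F N K k Ω U₀ 𝔥 dom levB Gp Δ2 a hposπ hposb hQ εC B₀ C₄ a₃ j a𝔄 ε₄).LieLinTokAt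
      (linPrOfRecord F N K k Ω U₀ 𝔥 levB a hposb hQ εC) (u x)) :
    ContDiffAt ℝ n (fun x (b : PBond (F.P K) 0) =>
      (((bgSchemePrOfRecord F N K k Ω U₀ 𝔥 dom levB Gp Δ2 a hposπ hposb hQ εC B₀ C₄ a₃ j a𝔄 ε₄).chartCfgLin
        (linPrOfRecord F N K k Ω U₀ 𝔥 levB a hposb hQ εC) (u x) b : SU N) : Matrix (Fin N) (Fin N) ℂ)) x₀ :=
  bgSchemePrOfRecord_contDiffAt_coe_chartCfgLin_comp_pi F N K k Ω U₀ 𝔥 dom levB Gp Δ2 a hposπ hposb hQ εC B₀ C₄ a₃ j a𝔄 ε₄ htok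
    (bgSchemePrOfRecord_contDiffAt_linPr_sol_add_shift_comp_of_regimeTok F N K k Ω U₀ 𝔥 dom levB Gp Δ2 a hposπ hposb hQ εC B₀ C₄ a₃ j a𝔄 ε₄
      hT hV₀ hW hu hx₀ hTan haC)

/-- ★★ **THE SAME FROM THE FRAMED SECT. C REGIME** (`RC`, `Prop4Hyp C^{sl,pr} C₂ c₄`, `ε₄ + a𝔄 ≤ a_C`, the eventual Lie token DISPLAYED).
[cite: Balaban1985Variational, Prop. 9 p.309, Prop. 3 p.289, (15) p.280, (47) p.285, (52)–(54) p.286] -/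
theorem bgSchemePrOfRecord_contDiffAt_coe_chartCfgLin_comp_pi_of_regimeC {n : WithTop ℕ∞}
    (hT : (bgSchemePrOfRecord F N K k Ω U₀ 𝔥 dom levB Gp Δ2 a hposπ hposb hQ εC B₀ C₄ a₃ j a𝔄 ε₄).RegimeTok)
    {V₀ : GaugeField (F.P K) k (SU N)} (hV₀ : V₀ ∈ dom) (hW : WAnalyticPrTok F N K k Ω U₀ 𝔥 levB Gp a hposb hQ εC a₃)
    {u : E → GaugeField (F.P K) k (SU N)} {x₀ : E} (hu : ContDiffAt ℝ n (fun x => coeField (u x)) x₀)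
    (hx₀ : coeField (u x₀) ∈ logPolydiscPrOfRecord F N K k Ω U₀ 𝔥 levB Gp Δ2 a hposπ hQ a𝔄) {b C₂ c₄ aC : ℝ}
    (RC : Regime (H1prOfRecordAtBg F N K k Ω U₀ 𝔥 levB a hposb hQ) (0 : Space115Lit F N K k Ω U₀ →L[ℂ] Space115Lit F N K k Ω U₀)
      (CslprOfRecord F N K k Ω U₀ 𝔥 levB) b 0 C₂ c₄ 0 aC εC)
    (hC : Prop4Hyp (CslprOfRecord F N K k Ω U₀ 𝔥 levB) C₂ c₄) (haC : ε₄ + a𝔄 ≤ aC)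
    (htok : ∀ᶠ x in 𝓝 x₀, (bgSchemePrOfRecord F N K k Ω U₀ 𝔥 dom levB Gp Δ2 a hposπ hposb hQ εC B₀ C₄ a₃ j a𝔄 ε₄).LieLinTokAt
      (linPrOfRecord F N K k Ω U₀ 𝔥 levB a hposb hQ εC) (u x)) :
    ContDiffAt ℝ n (fun x (b : PBond (F.P K) 0) =>
      (((bgSchemePrOfRecord F N K k Ω U₀ 𝔥 dom levB Gp Δ2 a hposπ hposb hQ εC B₀ C₄ a₃ j a𝔄 ε₄).chartCfgLin
        (linPrOfRecord F N K k Ω U₀ 𝔥 levB a hposb hQ εC) (u x) b : SU N) : Matrix (Fin N) (Fin N) ℂ)) x₀ :=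
  bgSchemePrOfRecord_contDiffAt_coe_chartCfgLin_comp_pi_of_regimeTok F N K k Ω U₀ 𝔥 dom levB Gp Δ2 a hposπ hposb hQ εC B₀ C₄ a₃ j a𝔄 ε₄
    hT hV₀ hW hu hx₀ (linPrAnalyticTok_of_regimeC F N K k Ω U₀ 𝔥 levB a hposb hQ RC hC) haC htok

/-- ★ **Cⁿ OF THE (47)-CARRYING LIE READING `x ↦ lieExpoLin T^{pr} (u x)` ALONG A DATUM MAP AT THE FRAMED RECORD** (the socket's `X := lieExpoLin T^{pr} ∘ datum`;
PRIMITIVE FORM from a `Cⁿ` transformed full small field), via (C1) `BgScheme.contDiffAt_lieExpoLin_comp`.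
[cite: Balaban1985Variational, Prop. 9 p.309, (15) p.280, (47) p.285] -/
theorem bgSchemePrOfRecord_contDiffAt_lieExpoLin_comp {n : WithTop ℕ∞} {u : E → GaugeField (F.P K) k (SU N)} {x₀ : E}
    (hd : ContDiffAt ℝ n (fun x => linPrOfRecord F N K k Ω U₀ 𝔥 levB a hposb hQ εC (u x)
      ((bgSchemePrOfRecord F N K k Ω U₀ 𝔥 dom levB Gp Δ2 a hposπ hposb hQ εC B₀ C₄ a₃ j a𝔄 ε₄).sol (u x) +
        (bgSchemePrOfRecord F N K k Ω U₀ 𝔥 dom levB Gp Δ2 a hposπ hposb hQ εC B₀ C₄ a₃ j a𝔄 ε₄).𝔄 (u x))) x₀) :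
    ContDiffAt ℝ n (fun x => (bgSchemePrOfRecord F N K k Ω U₀ 𝔥 dom levB Gp Δ2 a hposπ hposb hQ εC B₀ C₄ a₃ j a𝔄 ε₄).lieExpoLin
      (linPrOfRecord F N K k Ω U₀ 𝔥 levB a hposb hQ εC) (u x)) x₀ :=
  BgScheme.contDiffAt_lieExpoLin_comp _ _
    (bgSchemePrOfRecord_continuous_ev F N K k Ω U₀ 𝔥 dom levB Gp Δ2 a hposπ hposb hQ εC B₀ C₄ a₃ j a𝔄 ε₄) hd

/-- ★ **THE SAME FROM THE DISPLAYED TOKENS** (`RegimeTok`, `WAnalyticPrTok`, the datum in `logPolydiscPrOfRecord`, `LinPrAnalyticTok`, `ε₄ + a𝔄 ≤ a_C`).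
[cite: Balaban1985Variational, Prop. 9 p.309, Prop. 3 p.289, (15) p.280, (47) p.285, Prop. 6 p.295] -/
theorem bgSchemePrOfRecord_contDiffAt_lieExpoLin_comp_of_regimeTok {n : WithTop ℕ∞}
    (hT : (bgSchemePrOfRecord F N K k Ω U₀ 𝔥 dom levB Gp Δ2 a hposπ hposb hQ εC B₀ C₄ a₃ j a𝔄 ε₄).RegimeTok)
    {V₀ : GaugeField (F.P K) k (SU N)} (hV₀ : V₀ ∈ dom) (hW : WAnalyticPrTok F N K k Ω U₀ 𝔥 levB Gp a hposb hQ εC a₃)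
    {u : E → GaugeField (F.P K) k (SU N)} {x₀ : E} (hu : ContDiffAt ℝ n (fun x => coeField (u x)) x₀)
    (hx₀ : coeField (u x₀) ∈ logPolydiscPrOfRecord F N K k Ω U₀ 𝔥 levB Gp Δ2 a hposπ hQ a𝔄) {aC : ℝ}
    (hTan : LinPrAnalyticTok F N K k Ω U₀ 𝔥 levB a hposb hQ εC aC) (haC : ε₄ + a𝔄 ≤ aC) :
    ContDiffAt ℝ n (fun x => (bgSchemePrOfRecord F N K k Ω U₀ 𝔥 dom levB Gp Δ2 a hposπ hposb hQ εC B₀ C₄ a₃ j a𝔄 ε₄).lieExpoLin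
      (linPrOfRecord F N K k Ω U₀ 𝔥 levB a hposb hQ εC) (u x)) x₀ :=
  bgSchemePrOfRecord_contDiffAt_lieExpoLin_comp F N K k Ω U₀ 𝔥 dom levB Gp Δ2 a hposπ hposb hQ εC B₀ C₄ a₃ j a𝔄 ε₄
    (bgSchemePrOfRecord_contDiffAt_linPr_sol_add_shift_comp_of_regimeTok F N K k Ω U₀ 𝔥 dom levB Gp Δ2 a hposπ hposb hQ εC B₀ C₄ a₃ j a𝔄 ε₄
      hT hV₀ hW hu hx₀ hTan haC)

/-- ★ **THE SAME FROM THE FRAMED SECT. C REGIME** (`RC`, `Prop4Hyp C^{sl,pr} C₂ c₄`, `ε₄ + a𝔄 ≤ a_C` DISPLAYED).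
[cite: Balaban1985Variational, Prop. 9 p.309, Prop. 3 p.289, (15) p.280, (47) p.285, (52)–(54) p.286] -/
theorem bgSchemePrOfRecord_contDiffAt_lieExpoLin_comp_of_regimeC {n : WithTop ℕ∞}
    (hT : (bgSchemePrOfRecord F N K k Ω U₀ 𝔥 dom levB Gp Δ2 a hposπ hposb hQ εC B₀ C₄ a₃ j a𝔄 ε₄).RegimeTok)
    {V₀ : GaugeField (F.P K) k (SU N)} (hV₀ : V₀ ∈ dom) (hW : WAnalyticPrTok F N K k Ω U₀ 𝔥 levB Gp a hposb hQ εC a₃)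
    {u : E → GaugeField (F.P K) k (SU N)} {x₀ : E} (hu : ContDiffAt ℝ n (fun x => coeField (u x)) x₀)
    (hx₀ : coeField (u x₀) ∈ logPolydiscPrOfRecord F N K k Ω U₀ 𝔥 levB Gp Δ2 a hposπ hQ a𝔄) {b C₂ c₄ aC : ℝ}
    (RC : Regime (H1prOfRecordAtBg F N K k Ω U₀ 𝔥 levB a hposb hQ) (0 : Space115Lit F N K k Ω U₀ →L[ℂ] Space115Lit F N K k Ω U₀)
      (CslprOfRecord F N K k Ω U₀ 𝔥 levB) b 0 C₂ c₄ 0 aC εC)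
    (hC : Prop4Hyp (CslprOfRecord F N K k Ω U₀ 𝔥 levB) C₂ c₄) (haC : ε₄ + a𝔄 ≤ aC) :
    ContDiffAt ℝ n (fun x => (bgSchemePrOfRecord F N K k Ω U₀ 𝔥 dom levB Gp Δ2 a hposπ hposb hQ εC B₀ C₄ a₃ j a𝔄 ε₄).lieExpoLin
      (linPrOfRecord F N K k Ω U₀ 𝔥 levB a hposb hQ εC) (u x)) x₀ :=
  bgSchemePrOfRecord_contDiffAt_lieExpoLin_comp_of_regimeTok F N K k Ω U₀ 𝔥 dom levB Gp Δ2 a hposπ hposb hQ εC B₀ C₄ a₃ j a𝔄 ε₄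
    hT hV₀ hW hu hx₀ (linPrAnalyticTok_of_regimeC F N K k Ω U₀ 𝔥 levB a hposb hQ RC hC) haC

end Record

/-! ## §4. The flat datum at the unit background `U₀ = 1`, framed -/

section Flat

variable (F : T4Family) (N : ℕ) [NeZero N] (K : ℕ) (k : ℕ) (Ω : ℕ → Set (Site (F.P K) 0))
variable [Fact (0 < (F.L : ℝ))] [Fact (0 < (F.P K).eta k)] [Fact (0 < c0Rec F K k)] [Fact (∀ c, 0 < wBRec F K k c)]
variable (𝔥 : FrameDatum (F.P K) N k (1 : GaugeField (F.P K) 0 (SU N))) (dom : Set (GaugeField (F.P K) k (SU N))) (levB : PBond (F.P K) k → ℕ)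
  (Gp : SiteL2K ℂ (F.P K).d (fun _ => (F.P K).sitesPerDir 0) (c0Rec F K k) (WRec N) →ₗ[ℂ]
    SiteL2K ℂ (F.P K).d (fun _ => (F.P K).sitesPerDir 0) (c0Rec F K k) (WRec N))
  (Δ2 : BondL2K ℂ (F.P K).d (fun _ => (F.P K).sitesPerDir 0) (c0Rec F K k) (WRec N) →ₗ[ℂ]
    BondL2K ℂ (F.P K).d (fun _ => (F.P K).sitesPerDir 0) (c0Rec F K k) (WRec N)) (a : ℝ)
  (hposπ : ∀ x, x ≠ 0 → 0 < RCLike.re ⟪x, laplaceAOfRecordAt F N k (1 : GaugeField (F.P K) 0 (SU N))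
    (hessOpOfRecord128 F N k (1 : GaugeField (F.P K) 0 (SU N)) Gp (QprimeOfRecord F N k (1 : GaugeField (F.P K) 0 (SU N))) Δ2)
    (QprOfRecord F N k (1 : GaugeField (F.P K) 0 (SU N)) 𝔥) (QprimeOfRecord F N k (1 : GaugeField (F.P K) 0 (SU N))) a x⟫_ℂ)
  (hposb : ∀ x, x ≠ 0 → 0 < RCLike.re ⟪x, laplaceAOfRecord F N k (1 : GaugeField (F.P K) 0 (SU N))
    (QprOfRecord F N k (1 : GaugeField (F.P K) 0 (SU N)) 𝔥) (QprimeOfRecord F N k (1 : GaugeField (F.P K) 0 (SU N))) a x⟫_ℂ)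
  (hQ : Function.Surjective (QprOfRecord F N k (1 : GaugeField (F.P K) 0 (SU N)) 𝔥)) (εC B₀ C₄ a₃ j a𝔄 ε₄ : ℝ)

/-- E1 at the framed scheme: **at the unit background the current vanishes**, `J ≡ 0` (✓`JOfRecordAtBg_one`). [cite: Balaban1985Variational, (26)–(28) p.282] -/
theorem bgSchemePrOfRecord_J_one (V : GaugeField (F.P K) k (SU N)) :
    (bgSchemePrOfRecord F N K k Ω 1 𝔥 dom levB Gp Δ2 a hposπ hposb hQ εC B₀ C₄ a₃ j a𝔄 ε₄).J V = 0 :=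
  JOfRecordAtBg_one

/-- E2 at the framed scheme: **`𝔄(1) = 0` at the unit background** (`𝔄(Ū^kU₀) = 0` with `Ū^k(1) = 1`). [cite: Balaban1985Variational, (20) p.281, (103) p.293] -/
theorem bgSchemePrOfRecord_𝔄_one :
    (bgSchemePrOfRecord F N K k Ω 1 𝔥 dom levB Gp Δ2 a hposπ hposb hQ εC B₀ C₄ a₃ j a𝔄 ε₄).𝔄 1 = 0 := by
  have h := bgSchemePrOfRecord_𝔄_self F N K k Ω 1 𝔥 dom levB Gp Δ2 a hposπ hposb hQ εC B₀ C₄ a₃ j a𝔄 ε₄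
  rwa [avOfRecord_iter_one] at h

/-- ★ **`𝒜(1) = 0`: THE FIXED POINT OF THE FRAMED SCHEME VANISHES AT THE FLAT DATUM** (zero current, zero shift; uniqueness in the regime — DISPLAYED
`RegimeTok`, `1 ∈ dom`; the (47)-slot is not involved). [cite: Balaban1985Variational, Prop. 6 (116) p.295, Prop. 9 p.309] -/
theorem bgSchemePrOfRecord_sol_one (hT : (bgSchemePrOfRecord F N K k Ω 1 𝔥 dom levB Gp Δ2 a hposπ hposb hQ εC B₀ C₄ a₃ j a𝔄 ε₄).RegimeTok)
    (h1 : (1 : GaugeField (F.P K) k (SU N)) ∈ dom) :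
    (bgSchemePrOfRecord F N K k Ω 1 𝔥 dom levB Gp Δ2 a hposπ hposb hQ εC B₀ C₄ a₃ j a𝔄 ε₄).sol 1 = 0 := by
  obtain ⟨R, hJ, h𝔄⟩ := hT 1 h1
  exact BgScheme.sol_eq_zero R ((norm_nonneg _).trans hJ) ((norm_nonneg _).trans_lt h𝔄)
    (bgSchemePrOfRecord_J_one F N K k Ω 𝔥 dom levB Gp Δ2 a hposπ hposb hQ εC B₀ C₄ a₃ j a𝔄 ε₄ 1)
    (bgSchemePrOfRecord_𝔄_one F N K k Ω 𝔥 dom levB Gp Δ2 a hposπ hposb hQ εC B₀ C₄ a₃ j a𝔄 ε₄)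

/-- The (47)-carrying Lie token holds at the flat datum (zero exponent), given `T^{pr}_1(0) = 0` (PRIMITIVE `hT0`; supplier `linPrOfRecord_apply_zero`).
[cite: Balaban1985Variational, (15) p.280, (47) p.285, Prop. 9 p.309] -/
theorem bgSchemePrOfRecord_lieLinTokAt_one (hT : (bgSchemePrOfRecord F N K k Ω 1 𝔥 dom levB Gp Δ2 a hposπ hposb hQ εC B₀ C₄ a₃ j a𝔄 ε₄).RegimeTok)
    (h1 : (1 : GaugeField (F.P K) k (SU N)) ∈ dom) (hT0 : linPrOfRecord F N K k Ω 1 𝔥 levB a hposb hQ εC 1 0 = 0) :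
    (bgSchemePrOfRecord F N K k Ω 1 𝔥 dom levB Gp Δ2 a hposπ hposb hQ εC B₀ C₄ a₃ j a𝔄 ε₄).LieLinTokAt
      (linPrOfRecord F N K k Ω 1 𝔥 levB a hposb hQ εC) 1 :=
  BgScheme.lieLinTokAt_of_sol_eq_zero _ _ (bgSchemePrOfRecord_sol_one F N K k Ω 𝔥 dom levB Gp Δ2 a hposπ hposb hQ εC B₀ C₄ a₃ j a𝔄 ε₄ hT h1)
    (bgSchemePrOfRecord_𝔄_one F N K k Ω 𝔥 dom levB Gp Δ2 a hposπ hposb hQ εC B₀ C₄ a₃ j a𝔄 ε₄) hT0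

/-- The (47)-carrying Lie reading vanishes at the flat datum: `lieExpoLin T^{pr} 1 = 0`, given `T^{pr}_1(0) = 0`.
[cite: Balaban1985Variational, (15) p.280, (47) p.285, Prop. 9 p.309] -/
theorem bgSchemePrOfRecord_lieExpoLin_one (hT : (bgSchemePrOfRecord F N K k Ω 1 𝔥 dom levB Gp Δ2 a hposπ hposb hQ εC B₀ C₄ a₃ j a𝔄 ε₄).RegimeTok)
    (h1 : (1 : GaugeField (F.P K) k (SU N)) ∈ dom) (hT0 : linPrOfRecord F N K k Ω 1 𝔥 levB a hposb hQ εC 1 0 = 0) :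
    (bgSchemePrOfRecord F N K k Ω 1 𝔥 dom levB Gp Δ2 a hposπ hposb hQ εC B₀ C₄ a₃ j a𝔄 ε₄).lieExpoLin
      (linPrOfRecord F N K k Ω 1 𝔥 levB a hposb hQ εC) 1 = 0 :=
  BgScheme.lieExpoLin_eq_zero _ _ (bgSchemePrOfRecord_sol_one F N K k Ω 𝔥 dom levB Gp Δ2 a hposπ hposb hQ εC B₀ C₄ a₃ j a𝔄 ε₄ hT h1)
    (bgSchemePrOfRecord_𝔄_one F N K k Ω 𝔥 dom levB Gp Δ2 a hposπ hposb hQ εC B₀ C₄ a₃ j a𝔄 ε₄) hT0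

/-- ★★ **`chartCfgLin T^{pr} 1 = 1`: THE (47)-CARRYING CHART IMAGE OF THE FIXED POINT AT THE FLAT DATUM IS THE FLAT CONFIGURATION** — the K0 junction's `h1`
at the framed, (47)-carrying scheme (PRIMITIVE FORM: modulo the DISPLAYED `RegimeTok`, `1 ∈ dom` and `T^{pr}_1(0) = 0`).
[cite: Balaban1985Variational, (15) p.280, (47) p.285, Prop. 9 p.309] -/
theorem bgSchemePrOfRecord_chartCfgLin_one (hT : (bgSchemePrOfRecord F N K k Ω 1 𝔥 dom levB Gp Δ2 a hposπ hposb hQ εC B₀ C₄ a₃ j a𝔄 ε₄).RegimeTok)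
    (h1 : (1 : GaugeField (F.P K) k (SU N)) ∈ dom) (hT0 : linPrOfRecord F N K k Ω 1 𝔥 levB a hposb hQ εC 1 0 = 0) :
    (bgSchemePrOfRecord F N K k Ω 1 𝔥 dom levB Gp Δ2 a hposπ hposb hQ εC B₀ C₄ a₃ j a𝔄 ε₄).chartCfgLin
      (linPrOfRecord F N K k Ω 1 𝔥 levB a hposb hQ εC) 1 = 1 := by
  rw [BgScheme.chartCfgLin_eq_bg _ _ (bgSchemePrOfRecord_sol_one F N K k Ω 𝔥 dom levB Gp Δ2 a hposπ hposb hQ εC B₀ C₄ a₃ j a𝔄 ε₄ hT h1)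
    (bgSchemePrOfRecord_𝔄_one F N K k Ω 𝔥 dom levB Gp Δ2 a hposπ hposb hQ εC B₀ C₄ a₃ j a𝔄 ε₄) hT0]
  rfl

/-- ★★ **THE SAME FROM THE FRAMED SECT. C REGIME** (`T^{pr}_1(0) = 0` by lit ✓`T47_zero` under the DISPLAYED `RC` and `0 < a_C`).
[cite: Balaban1985Variational, (15) p.280, (47) p.285, Prop. 3 p.289, Prop. 9 p.309] -/
theorem bgSchemePrOfRecord_chartCfgLin_one_of_regimeC
    (hT : (bgSchemePrOfRecord F N K k Ω 1 𝔥 dom levB Gp Δ2 a hposπ hposb hQ εC B₀ C₄ a₃ j a𝔄 ε₄).RegimeTok)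
    (h1 : (1 : GaugeField (F.P K) k (SU N)) ∈ dom) {b C₂ c₄ aC : ℝ}
    (RC : Regime (H1prOfRecordAtBg F N K k Ω 1 𝔥 levB a hposb hQ) (0 : Space115Lit F N K k Ω 1 →L[ℂ] Space115Lit F N K k Ω 1)
      (CslprOfRecord F N K k Ω 1 𝔥 levB) b 0 C₂ c₄ 0 aC εC) (haC : 0 < aC) :
    (bgSchemePrOfRecord F N K k Ω 1 𝔥 dom levB Gp Δ2 a hposπ hposb hQ εC B₀ C₄ a₃ j a𝔄 ε₄).chartCfgLin
      (linPrOfRecord F N K k Ω 1 𝔥 levB a hposb hQ εC) 1 = 1 :=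
  bgSchemePrOfRecord_chartCfgLin_one F N K k Ω 𝔥 dom levB Gp Δ2 a hposπ hposb hQ εC B₀ C₄ a₃ j a𝔄 ε₄ hT h1
    (linPrOfRecord_apply_zero F N K k Ω 1 𝔥 levB a hposb hQ εC RC haC 1)

/-- **(s-exp) AT THE FRAMED RECORD, `U₀ = 1`, eventual form along a datum map**: `chartCfgLin T^{pr} ∘ u =ᶠ[l] (x ↦ expChart 1 (lieExpoLin T^{pr} (u x)))` whenever the
(47)-carrying Lie token holds eventually along `u` ((C1) `BgScheme.chartCfgLin_comp_eventuallyEq_expChart`; `bg ≡ 1`).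
[cite: Balaban1985Variational, (15) p.280, (19) p.281, (47) p.285] -/
theorem bgSchemePrOfRecord_chartCfgLin_comp_eventuallyEq_expChart {E : Type*} {l : Filter E} {u : E → GaugeField (F.P K) k (SU N)}
    (htok : ∀ᶠ x in l, (bgSchemePrOfRecord F N K k Ω 1 𝔥 dom levB Gp Δ2 a hposπ hposb hQ εC B₀ C₄ a₃ j a𝔄 ε₄).LieLinTokAt
      (linPrOfRecord F N K k Ω 1 𝔥 levB a hposb hQ εC) (u x)) :
    (fun x => (bgSchemePrOfRecord F N K k Ω 1 𝔥 dom levB Gp Δ2 a hposπ hposb hQ εC B₀ C₄ a₃ j a𝔄 ε₄).chartCfgLin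
        (linPrOfRecord F N K k Ω 1 𝔥 levB a hposb hQ εC) (u x)) =ᶠ[l]
      fun x => expChart 1 ((bgSchemePrOfRecord F N K k Ω 1 𝔥 dom levB Gp Δ2 a hposπ hposb hQ εC B₀ C₄ a₃ j a𝔄 ε₄).lieExpoLin
        (linPrOfRecord F N K k Ω 1 𝔥 levB a hposb hQ εC) (u x)) :=
  BgScheme.chartCfgLin_comp_eventuallyEq_expChart _ _ (fun _ => rfl) htok

/-- **The flat datum lies in `logPolydiscPrOfRecord` at `U₀ = 1`** (`coeField 1`; needs only `0 < a𝔄`). [cite: Balaban1985Variational, (20) p.281, Prop. 6 p.295] -/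
theorem coeField_one_mem_logPolydiscPrOfRecord (ha : 0 < a𝔄) :
    coeField (1 : GaugeField (F.P K) k (SU N)) ∈ logPolydiscPrOfRecord F N K k Ω 1 𝔥 levB Gp Δ2 a hposπ hQ a𝔄 := by
  have h := coeField_iter_mem_logPolydiscPrOfRecord F N K k Ω 1 𝔥 levB Gp Δ2 a hposπ hQ a𝔄 ha
  rwa [avOfRecord_iter_one] at h

end Flat

end Literature.MathematicalPhysics.QuantumFieldTheory.Balaban1983to89.Node00
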